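import Summits.CriticalPhenomena.PercolationContinuityZ3.Theorems.PercNearOneGluingNoHeavyLowerTailSahiGridPatternCellForm

/-!
# `NoHeavyLowerTail` (crux stmt-CriticalPhenomena-4575), Sahi programme P1: **ATOMS OF THE CYLINDER-CLOSURE LP** (every `k`, every `n`)

Support file (Sahi cell, seat `prim-sahi-p1`, generation 11; `--supports stmt-CriticalPhenomena-4575`).  Pure proofs plus the two coefficient
matrices `tgtT`, `tgtN` of the cell form; no `sorry`, standard axioms.  Continues `…SahiGridPatternCellForm`.

Linear forms in the cell statistics `cellT`, `cellN` (as pairings `pairT M`, `pairN M` with explicit matrices `M` on `[3]^k × [3]^k`) that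
are NONNEGATIVE for all up-sets `B, C ⊆ [3]^{n+k}` and every `n`:
* `cellN_le_cellT` — coefficientwise Harris on the fibres (`H[q|r]`);
* `pairT_sliceBeta_eq` / `pairN_sliceBeta_eq`: `Σ β_V·cellT = 2^n Σ_ξ S_k(V,B^ξ,C^ξ)`, `Σ β_V·cellN = Σ_{ξ δ̸ η} S_k(V,B^ξ,C^η)`, hence
  `pairT_sliceBeta_nonneg` / `pairN_sliceBeta_nonneg` whenever `V` is a good first slot of `[3]^k` (e.g. by `PatternPos k`) (`PPT(V)`, `PPN(V)`);
* `sum_klCoef_ind_nonneg` — KLEITMAN IN THE CUBE AROUND A CELL `q`: `Σ_{r δ̸ q, r ∈ X}(1_U(r) − 1_U(r̄)) ≥ 0` for up-sets `U, X` — and the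
  `U`-AWARE atoms `klT_nonneg`, `klN_nonneg`, `klT'_nonneg`, `klN'_nonneg` (one side a Kleitman column, the other a dual-cone generator);
* `gvalT_nonneg`, `gvalN_nonneg` — products of dual-cone generators (`PT`, `PN`).
Finally `sStarD_cylSet_eq_pair`: `sStarD (cylSet U) B C = pairT (tgtT U) B C + pairN (tgtN U) B C`, and linearity of the pairings — so a
nonnegative integer combination of atom matrices equal to `L·(tgtT U, tgtN U)` proves that the cylinder over `U` is a good first slot in
EVERY dimension (checker in `…SahiGridPatternCellCheck`).  Numerically: the LP over these columns is feasible for all 12 classes of up-sets of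
`[3]^2` and (running) `[3]^3` (seat folder code/cyllp2.py, kit j135524/j135540). [this work]
-/

namespace Summit.CriticalPhenomena.PercolationContinuityZ3.Theorems.SahiGridPattern

open Finset SahiGrid3
open scoped BigOperators FinsetFamily

variable {n k : ℕ}

/-! ### Atoms I: Harris on the fibres -/

/-- **Harris atom**: `cellN B C q r ≤ cellT B C q r` for up-sets `B, C` (coefficientwise Harris on the cell fibres `B_q, C_r ⊆ [3]^n`).
[this work] -/
theorem cellN_le_cellT {B C : Finset (Pd (n + k))} (hB : IsUpperSet (B : Set (Pd (n + k)))) (hC : IsUpperSet (C : Set (Pd (n + k))))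
    (q r : Pd k) : cellN B C q r ≤ cellT B C q r := by
  have h := sum_ind_totDist_le n (fibre B q) (fibre C r) (isUpperSet_fibre hB q) (isUpperSet_fibre hC r)
  unfold cellN cellT
  simp_rw [← ind_fibre B q, ← ind_fibre C r]
  exact h

/-- `pairT` expanded: `pairT M B C = 2^n Σ_ξ Σ_q Σ_r M q r · 1_B(glue ξ q) · 1_C(glue ξ r)`. [this work] -/
theorem pairT_expand (M : Pd k → Pd k → ℤ) (B C : Finset (Pd (n + k))) :
    pairT M B C = 2 ^ n * ∑ ξ : Pd n, ∑ q : Pd k, ∑ r : Pd k, M q r * (ind B (glue ξ q) * ind C (glue ξ r)) := by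
  unfold pairT cellT
  have e : ∀ q r : Pd k, M q r * (2 ^ n * ∑ ξ : Pd n, ind B (glue ξ q) * ind C (glue ξ r)) =
      ∑ ξ : Pd n, 2 ^ n * (M q r * (ind B (glue ξ q) * ind C (glue ξ r))) := by
    intro q r; rw [Finset.mul_sum, Finset.mul_sum]; refine Finset.sum_congr rfl fun ξ _ => ?_; ring
  simp_rw [e]
  rw [sum_comm3 (fun q r ξ => (2:ℤ) ^ n * (M q r * (ind B (glue ξ q) * ind C (glue ξ r))))]
  rw [Finset.mul_sum]
  refine Finset.sum_congr rfl fun ξ _ => ?_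
  rw [Finset.mul_sum]
  refine Finset.sum_congr rfl fun q _ => ?_
  rw [Finset.mul_sum]

/-- `pairN` expanded: `pairN M B C = Σ_ξ Σ_η [ξ δ̸ η] Σ_q Σ_r M q r · 1_B(glue ξ q) · 1_C(glue η r)`. [this work] -/
theorem pairN_expand (M : Pd k → Pd k → ℤ) (B C : Finset (Pd (n + k))) :
    pairN M B C = ∑ ξ : Pd n, ∑ η : Pd n, (if TotDist ξ η = true then (1:ℤ) else 0) *
      ∑ q : Pd k, ∑ r : Pd k, M q r * (ind B (glue ξ q) * ind C (glue η r)) := by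
  unfold pairN cellN
  have e : ∀ q r : Pd k, M q r * (∑ ξ : Pd n, ∑ η : Pd n, ind B (glue ξ q) * ind C (glue η r) * (if TotDist ξ η = true then (1:ℤ) else 0)) =
      ∑ ξ : Pd n, ∑ η : Pd n, (if TotDist ξ η = true then (1:ℤ) else 0) * (M q r * (ind B (glue ξ q) * ind C (glue η r))) := by
    intro q r; rw [Finset.mul_sum]; refine Finset.sum_congr rfl fun ξ _ => ?_; rw [Finset.mul_sum]
    refine Finset.sum_congr rfl fun η _ => ?_; ring
  simp_rw [e]
  rw [sum_comm4 (fun q r ξ η => (if TotDist ξ η = true then (1:ℤ) else 0) * (M q r * (ind B (glue ξ q) * ind C (glue η r))))]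
  refine Finset.sum_congr rfl fun ξ _ => Finset.sum_congr rfl fun η _ => ?_
  rw [Finset.mul_sum]
  refine Finset.sum_congr rfl fun q _ => ?_
  rw [Finset.mul_sum]

/-- The pattern functional on sections as a cell double sum. [this work] -/
theorem sStarD_sect_eq (V : Finset (Pd k)) (B C : Finset (Pd (n + k))) (ξ η : Pd n) :
    sStarD V (sect B ξ) (sect C η) = ∑ q : Pd k, ∑ r : Pd k, sliceBeta V q r * (ind B (glue ξ q) * ind C (glue η r)) := by
  unfold sliceBeta
  rw [sStarD_eq_sum_tcD, Finset.sum_comm]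
  rw [← Finset.sum_subset (Finset.subset_univ (sect B ξ)) (fun q _ hq => by
        refine Finset.sum_eq_zero fun r _ => ?_
        have : ind B (glue ξ q) = 0 := by unfold ind; rw [if_neg]; unfold sect at hq; simpa using hq
        rw [this]; ring)]
  refine Finset.sum_congr rfl fun q hq => ?_
  rw [Finset.sum_comm]
  rw [← Finset.sum_subset (Finset.subset_univ (sect C η)) (fun r _ hr => by
        have : ind C (glue η r) = 0 := by unfold ind; rw [if_neg]; unfold sect at hr; simpa using hr
        rw [this]; ring)]
  refine Finset.sum_congr rfl fun r hr => ?_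
  have hq' : ind B (glue ξ q) = 1 := by unfold ind; rw [if_pos]; unfold sect at hq; simpa using hq
  have hr' : ind C (glue η r) = 1 := by unfold ind; rw [if_pos]; unfold sect at hr; simpa using hr
  rw [hq', hr']; ring

/-! ### Atoms II: the good-slot atoms (a good slot `V` of `[3]^k`, e.g. `PatternPos k`, on the sections) -/

/-- `Σ_{q,r} β_V(q,r)·cellT B C q r = 2^n · Σ_ξ sStarD V B^ξ C^ξ`. [this work] -/
theorem pairT_sliceBeta_eq (V : Finset (Pd k)) (B C : Finset (Pd (n + k))) :
    pairT (sliceBeta V) B C = 2 ^ n * ∑ ξ : Pd n, sStarD V (sect B ξ) (sect C ξ) := by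
  rw [pairT_expand]
  simp_rw [sStarD_sect_eq]

/-- `Σ_{q,r} β_V(q,r)·cellN B C q r = Σ_{ξ δ̸ η} sStarD V B^ξ C^η`. [this work] -/
theorem pairN_sliceBeta_eq (V : Finset (Pd k)) (B C : Finset (Pd (n + k))) :
    pairN (sliceBeta V) B C = ∑ ξ : Pd n, ∑ η : Pd n, (if TotDist ξ η = true then (1:ℤ) else 0) * sStarD V (sect B ξ) (sect C η) := by
  rw [pairN_expand]
  simp_rw [sStarD_sect_eq]

/-- **Good-slot atom, `T`-version**: if `V` is a good first slot of `[3]^k` then `Σ β_V·cellT ≥ 0` for all up-sets `B, C` of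
`[3]^{n+k}`. [this work] -/
theorem pairT_sliceBeta_nonneg {V : Finset (Pd k)}
    (hV : ∀ X Y : Finset (Pd k), IsUpperSet (X : Set (Pd k)) → IsUpperSet (Y : Set (Pd k)) → 0 ≤ sStarD V X Y)
    {B C : Finset (Pd (n + k))} (hB : IsUpperSet (B : Set (Pd (n + k)))) (hC : IsUpperSet (C : Set (Pd (n + k)))) :
    0 ≤ pairT (sliceBeta V) B C := by
  rw [pairT_sliceBeta_eq]
  exact mul_nonneg (pow_nonneg (by norm_num) _)
    (Finset.sum_nonneg fun ξ _ => hV _ _ (isUpperSet_sect hB ξ) (isUpperSet_sect hC ξ))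

/-- **Good-slot atom, `N`-version**: `Σ β_V·cellN ≥ 0`. [this work] -/
theorem pairN_sliceBeta_nonneg {V : Finset (Pd k)}
    (hV : ∀ X Y : Finset (Pd k), IsUpperSet (X : Set (Pd k)) → IsUpperSet (Y : Set (Pd k)) → 0 ≤ sStarD V X Y)
    {B C : Finset (Pd (n + k))} (hB : IsUpperSet (B : Set (Pd (n + k)))) (hC : IsUpperSet (C : Set (Pd (n + k)))) :
    0 ≤ pairN (sliceBeta V) B C := by
  rw [pairN_sliceBeta_eq]
  refine Finset.sum_nonneg fun ξ _ => Finset.sum_nonneg fun η _ => mul_nonneg ?_ (hV _ _ (isUpperSet_sect hB ξ) (isUpperSet_sect hC η))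
  split_ifs <;> norm_num

/-! ### Atoms III: Kleitman in the cube around a cell (`U`-aware atoms) -/

/-- **Kleitman around `q`** (every `k`): for up-sets `U, X ⊆ [3]^k` and any cell `q`,
`Σ_{r δ̸ q, r ∈ X} (1_U(r) − 1_U(r̄)) ≥ 0` (`r̄` the third point of `r, q`): the trace of `X` on the Boolean cube around `q` meets `U`
at least as often as it meets the complements of `U` (Kleitman's lemma, then Harris). [this work] -/
theorem sum_klCoef_ind_nonneg {U X : Finset (Pd k)} (hU : IsUpperSet (U : Set (Pd k))) (hX : IsUpperSet (X : Set (Pd k)))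
    (q : Pd k) : 0 ≤ ∑ r : Pd k, klCoef U q r * ind X r := by
  have h1 : (∑ r : Pd k, klCoef U q r * ind X r) =
      ∑ r ∈ univ.filter (fun r : Pd k => TotDist r q = true), (ind U r - ind U (thirdPt r q)) * ind X r := by
    rw [Finset.sum_filter]
    refine Finset.sum_congr rfl fun r _ => ?_
    unfold klCoef; split_ifs <;> ring
  rw [h1, sum_totDist_eq_sum_sets q (fun r => (ind U r - ind U (thirdPt r q)) * ind X r)]
  simp only [thirdPt_fromSet, sub_mul, Finset.sum_sub_distrib]
  have e1 : (∑ T : Finset (Fin k), ind U (fromSet q T) * ind X (fromSet q T)) = ((fam q X ∩ fam q U).card : ℤ) := by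
    simp only [ind_mul_ite]; rw [sum_ite_eq_card]; congr 2; ext T; simp [mem_fam, and_comm]
  have e2 : (∑ T : Finset (Fin k), ind U (fromSet q Tᶜ) * ind X (fromSet q T)) = ((fam q X ∩ (fam q U)ᶜˢ).card : ℤ) := by
    simp only [ind_mul_ite]; rw [sum_ite_eq_card]; congr 2; ext T; simp [mem_fam, mem_compls, and_comm]
  rw [e1, e2]
  have k := card_inter_compls_le (isUpperSet_fam q hX) (isUpperSet_fam q hU)
  omega

/-- Dual-cone generators (`gval`, point or upward difference) are nonnegative on the sections of an up-set. [this work] -/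
theorem sectNonneg_gval {B : Finset (Pd (n + k))} (hB : IsUpperSet (B : Set (Pd (n + k)))) {e : Pd k × Pd k} (he : e.1 ≤ e.2) :
    ∀ ξ : Pd n, 0 ≤ ∑ p : Pd k, gval e p * ind B (glue ξ p) := by
  intro ξ
  have h : (∑ p : Pd k, gval e p * ind B (glue ξ p)) = ∑ p ∈ sect B ξ, gval e p := by
    rw [← Finset.sum_subset (Finset.subset_univ (sect B ξ)) (fun p _ hp => by
          have : ind B (glue ξ p) = 0 := by unfold ind; rw [if_neg]; unfold sect at hp; simpa using hp
          rw [this]; ring)]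
    refine Finset.sum_congr rfl fun p hp => ?_
    have : ind B (glue ξ p) = 1 := by unfold ind; rw [if_pos]; unfold sect at hp; simpa using hp
    rw [this]; ring
  rw [h]
  exact sum_gval_nonneg (isUpperSet_sect hB ξ) he

/-- Kleitman column sums on sections of an up-set are nonnegative. [this work] -/
theorem sectNonneg_klCoef {U : Finset (Pd k)} (hU : IsUpperSet (U : Set (Pd k))) {C : Finset (Pd (n + k))}
    (hC : IsUpperSet (C : Set (Pd (n + k)))) (q : Pd k) : ∀ ξ : Pd n, 0 ≤ ∑ p : Pd k, klCoef U q p * ind C (glue ξ p) := by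
  intro ξ
  have h := sum_klCoef_ind_nonneg hU (isUpperSet_sect hC ξ) q
  simp_rw [ind_sect] at h
  exact h

/-- **Product atom, `T`-version**: `Σ_{p,r} w(p)w'(r)·cellT B C p r = 2^n Σ_ξ (Σ_p w(p)1_B(glue ξ p))(Σ_r w'(r)1_C(glue ξ r)) ≥ 0`
for weights that are nonnegative on every section (the rôle of dual-cone generators). [this work] -/
theorem prodT_nonneg {w w' : Pd k → ℤ} {B C : Finset (Pd (n + k))} (hw : ∀ ξ : Pd n, 0 ≤ ∑ p : Pd k, w p * ind B (glue ξ p))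
    (hw' : ∀ ξ : Pd n, 0 ≤ ∑ p : Pd k, w' p * ind C (glue ξ p)) :
    0 ≤ pairT (fun p r => w p * w' r) B C := by
  rw [pairT_expand]
  refine mul_nonneg (pow_nonneg (by norm_num) _) (Finset.sum_nonneg fun ξ _ => ?_)
  have e : (∑ q : Pd k, ∑ r : Pd k, w q * w' r * (ind B (glue ξ q) * ind C (glue ξ r))) =
      (∑ q : Pd k, w q * ind B (glue ξ q)) * (∑ r : Pd k, w' r * ind C (glue ξ r)) := by
    rw [Finset.sum_mul_sum]
    refine Finset.sum_congr rfl fun q _ => Finset.sum_congr rfl fun r _ => ?_; ring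
  rw [e]
  exact mul_nonneg (hw ξ) (hw' ξ)

/-- **Product atom, `N`-version**: `Σ_{p,r} w(p)w'(r)·cellN B C p r ≥ 0`. [this work] -/
theorem prodN_nonneg {w w' : Pd k → ℤ} {B C : Finset (Pd (n + k))} (hw : ∀ ξ : Pd n, 0 ≤ ∑ p : Pd k, w p * ind B (glue ξ p))
    (hw' : ∀ ξ : Pd n, 0 ≤ ∑ p : Pd k, w' p * ind C (glue ξ p)) :
    0 ≤ pairN (fun p r => w p * w' r) B C := by
  rw [pairN_expand]
  refine Finset.sum_nonneg fun ξ _ => Finset.sum_nonneg fun η _ => mul_nonneg (by split_ifs <;> norm_num) ?_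
  have e : (∑ q : Pd k, ∑ r : Pd k, w q * w' r * (ind B (glue ξ q) * ind C (glue η r))) =
      (∑ q : Pd k, w q * ind B (glue ξ q)) * (∑ r : Pd k, w' r * ind C (glue η r)) := by
    rw [Finset.sum_mul_sum]
    refine Finset.sum_congr rfl fun q _ => Finset.sum_congr rfl fun r _ => ?_; ring
  rw [e]
  exact mul_nonneg (hw ξ) (hw' η)

/-- **Kleitman atom `KT`**: B-side generator `e`, C-side Kleitman column around `q`. [this work] -/
theorem klT_nonneg {U : Finset (Pd k)} (hU : IsUpperSet (U : Set (Pd k))) {B C : Finset (Pd (n + k))}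
    (hB : IsUpperSet (B : Set (Pd (n + k)))) (hC : IsUpperSet (C : Set (Pd (n + k)))) {e : Pd k × Pd k} (he : e.1 ≤ e.2) (q : Pd k) :
    0 ≤ pairT (fun p r => gval e p * klCoef U q r) B C :=
  prodT_nonneg (sectNonneg_gval hB he) (sectNonneg_klCoef hU hC q)

/-- **Kleitman atom `KN`**. [this work] -/
theorem klN_nonneg {U : Finset (Pd k)} (hU : IsUpperSet (U : Set (Pd k))) {B C : Finset (Pd (n + k))}
    (hB : IsUpperSet (B : Set (Pd (n + k)))) (hC : IsUpperSet (C : Set (Pd (n + k)))) {e : Pd k × Pd k} (he : e.1 ≤ e.2) (q : Pd k) :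
    0 ≤ pairN (fun p r => gval e p * klCoef U q r) B C :=
  prodN_nonneg (sectNonneg_gval hB he) (sectNonneg_klCoef hU hC q)

/-- **Kleitman atom `KT'`** (B-side Kleitman column around `q`, C-side generator). [this work] -/
theorem klT'_nonneg {U : Finset (Pd k)} (hU : IsUpperSet (U : Set (Pd k))) {B C : Finset (Pd (n + k))}
    (hB : IsUpperSet (B : Set (Pd (n + k)))) (hC : IsUpperSet (C : Set (Pd (n + k)))) {e : Pd k × Pd k} (he : e.1 ≤ e.2) (q : Pd k) :
    0 ≤ pairT (fun p r => klCoef U q p * gval e r) B C :=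
  prodT_nonneg (sectNonneg_klCoef hU hB q) (sectNonneg_gval hC he)

/-- **Kleitman atom `KN'`**. [this work] -/
theorem klN'_nonneg {U : Finset (Pd k)} (hU : IsUpperSet (U : Set (Pd k))) {B C : Finset (Pd (n + k))}
    (hB : IsUpperSet (B : Set (Pd (n + k)))) (hC : IsUpperSet (C : Set (Pd (n + k)))) {e : Pd k × Pd k} (he : e.1 ≤ e.2) (q : Pd k) :
    0 ≤ pairN (fun p r => klCoef U q p * gval e r) B C :=
  prodN_nonneg (sectNonneg_klCoef hU hB q) (sectNonneg_gval hC he)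

/-- **Generator-product atoms** (the `PT`/`PN` columns: both sides dual-cone generators). [this work] -/
theorem gvalT_nonneg {B C : Finset (Pd (n + k))} (hB : IsUpperSet (B : Set (Pd (n + k)))) (hC : IsUpperSet (C : Set (Pd (n + k))))
    {e e' : Pd k × Pd k} (he : e.1 ≤ e.2) (he' : e'.1 ≤ e'.2) : 0 ≤ pairT (fun p r => gval e p * gval e' r) B C :=
  prodT_nonneg (sectNonneg_gval hB he) (sectNonneg_gval hC he')

/-- `PN` column. [this work] -/
theorem gvalN_nonneg {B C : Finset (Pd (n + k))} (hB : IsUpperSet (B : Set (Pd (n + k)))) (hC : IsUpperSet (C : Set (Pd (n + k))))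
    {e e' : Pd k × Pd k} (he : e.1 ≤ e.2) (he' : e'.1 ≤ e'.2) : 0 ≤ pairN (fun p r => gval e p * gval e' r) B C :=
  prodN_nonneg (sectNonneg_gval hB he) (sectNonneg_gval hC he')

/-! ### The cell form as a pairing, and the linear-certificate principle -/

/-- Diagonal coefficient matrix of the cell form. [this work] -/
def tgtT (U : Finset (Pd k)) (q r : Pd k) : ℤ := if q = r then lamU U q else 0

/-- Off-diagonal coefficient matrix of the cell form. [this work] -/
def tgtN (U : Finset (Pd k)) (q r : Pd k) : ℤ := - thetaVal U q r

/-- The cell form as a pairing: `sStarD (cylSet U) B C = pairT (tgtT U) B C + pairN (tgtN U) B C`. [this work] -/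
theorem sStarD_cylSet_eq_pair (U : Finset (Pd k)) (B C : Finset (Pd (n + k))) :
    sStarD (cylSet U : Finset (Pd (n + k))) B C = pairT (tgtT U) B C + pairN (tgtN U) B C := by
  rw [sStarD_cylSet_eq]
  unfold pairT pairN tgtT tgtN
  have h1 : (∑ q : Pd k, lamU U q * cellT B C q q) = ∑ q : Pd k, ∑ r : Pd k, (if q = r then lamU U q else 0) * cellT B C q r := by
    refine Finset.sum_congr rfl fun q _ => ?_
    rw [Finset.sum_eq_single q (fun r _ hne => by rw [if_neg (Ne.symm hne)]; ring) (fun h => absurd (mem_univ q) h)]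
    rw [if_pos rfl]
  rw [h1]
  simp only [neg_mul, Finset.sum_neg_distrib]
  ring

/-- `pairT` is linear in the matrix: finite combinations. [this work] -/
theorem pairT_smul_add (c : ℤ) (M M' : Pd k → Pd k → ℤ) (B C : Finset (Pd (n + k))) :
    pairT (fun q r => c * M q r + M' q r) B C = c * pairT M B C + pairT M' B C := by
  unfold pairT
  simp only [add_mul, Finset.sum_add_distrib, mul_assoc, Finset.mul_sum]

/-- `pairN` is linear in the matrix. [this work] -/
theorem pairN_smul_add (c : ℤ) (M M' : Pd k → Pd k → ℤ) (B C : Finset (Pd (n + k))) :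
    pairN (fun q r => c * M q r + M' q r) B C = c * pairN M B C + pairN M' B C := by
  unfold pairN
  simp only [add_mul, Finset.sum_add_distrib, mul_assoc, Finset.mul_sum]

/-- `pairT` of the zero matrix. [this work] -/
theorem pairT_zero (B C : Finset (Pd (n + k))) : pairT (fun _ _ => (0:ℤ)) B C = 0 := by
  unfold pairT; simp

/-- `pairN` of the zero matrix. [this work] -/
theorem pairN_zero (B C : Finset (Pd (n + k))) : pairN (fun _ _ => (0:ℤ)) B C = 0 := by
  unfold pairN; simp

/-- `pairT` respects pointwise equality of matrices. [this work] -/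
theorem pairT_congr {M M' : Pd k → Pd k → ℤ} (h : ∀ q r, M q r = M' q r) (B C : Finset (Pd (n + k))) : pairT M B C = pairT M' B C := by
  unfold pairT; simp_rw [h]

/-- `pairN` respects pointwise equality of matrices. [this work] -/
theorem pairN_congr {M M' : Pd k → Pd k → ℤ} (h : ∀ q r, M q r = M' q r) (B C : Finset (Pd (n + k))) : pairN M B C = pairN M' B C := by
  unfold pairN; simp_rw [h]

end Summit.CriticalPhenomena.PercolationContinuityZ3.Theorems.SahiGridPattern
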